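import Mathlib
import Summits.Schanuel.Schanuel.Theses.RigidCore
import Summits.Schanuel.Schanuel.Theorems.AclSubsetLogFreeCore.Negative.LogTwoHub
import Literature.ModelTheory.ExponentialFields.DefinabilityParams

/-!
# Crux `AclSubsetLogFreeCore` — accidental relations feed the hub (cdisprove gen 4, part 2)

Continuation of `LogTwoHub.lean` (crux stmt-Schanuel-0968, (A) `acl^{ℂ_exp}(∅) ⊆ C_EA`).
Everything is sorry-free; the route's support item `TwoLogsBranchRelationFinite` (Theorem L over
Baker, not yet landed) enters as an explicit HYPOTHESIS `hL`.

* §1 For `R ∈ ℤ[X, W]`, `s_R = {x | e^x = 2 ∧ ∃ w (e^w = 3 ∧ R(x, w) = 0)}` is `∅`-definable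
  (`definable₁_branchRelationSet`) and, for non-constant `R`, finite by Theorem L
  (`finite_branchRelationSet`; uses `linearIndependent_log_two_log_three_two_pi_I`).  So ONE
  algebraic relation `R(ln 2 + 2πij, ln 3 + 2πik) = 0` makes `ln 2` pointwise `∅`-definable
  (`log_two_mem_expDcl_of_branchRelation`, by conjugation averaging), and then (A) forces
  `ln 2 ∈ C_EA` (`log_two_mem_logFreeCore_of_crux_of_branchRelation`).  Consequently
  **(A) ∧ Theorem L ⇒ `ln 2 ∈ C_EA` ∨ (`log 2`, `log 3` algebraically independent over `ℚ` in ALL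
  branches)** (`logFree_or_allBranchIndep_of_crux`) — a disjunction of an SC-false statement and an
  open problem of transcendence theory ("it is not known whether there exist two algebraically
  independent logarithms of algebraic numbers", Waldschmidt 2000 §1.4): **(A) is not a soft
  statement**.  This is the `ℂ`-shadow of the failure of (A) in a Bays–Kirby field `𝕄(F)` built on
  such an accidental relation (crux ideate-2, findings F2/F3): in `ℂ` the relation cannot be refuted,
  so (A) pays for it with `ln 2 ∈ C_EA`.
* §2 **KMO hinge.**  `ln 2 ∈ dcl(∅) ⇒ 2^{1/n} = e^{(ln 2)/n} ∈ dcl(∅)` for every `n ≥ 1`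
  (`root_two_mem_expDcl_of_log_two_mem_expDcl`); contrapositively, with Theorem L, the
  NON-definability in `ℂ_exp` of the single algebraic number `2^{1/3}` (an instance of
  Kirby–Macintyre–Onshuus' open question; expected under Zilber's conjecture, where
  `dcl(∅) ∩ ℚ̄ = ℚ^{ab} ∩ ℝ`) already implies the all-branch algebraic independence of `log 2` and
  `log 3` (`allBranchIndep_of_root_two_not_mem_expDcl`) — a "symmetry ⇒ transcendence" transfer with
  a weaker symmetric hypothesis than the route's `EndomorphismMovingLogTwo`.
* §3 **Automorphisms and the hub.**  Automorphisms of `ℂ_exp` (`Language.expRing.Equiv ℂ ℂ`) fix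
  `dcl(∅)` pointwise and give finite orbits on `acl(∅)`; so ONE automorphism moving `ln 2` denies the
  hub, settles (A)|_{T₂} vacuously (`branch_not_mem_expAcl_of_equiv_apply_ne`) and, modulo Theorem L,
  proves all-branch `log 2 ⊥ log 3` (`allBranchIndep_of_equiv_apply_ne`); conversely a refutation of
  (A) exhibits a real number outside `C_EA` fixed by all of `Aut(ℂ_exp)` (`exists_fixed_real_not_mem_of_not`)
  — it would deny the Zilber-homogeneity picture, which is why no kill is expected.

## References

* J. Kirby, A. Macintyre, A. Onshuus, *The algebraic numbers definable in various exponential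
  fields*, J. Inst. Math. Jussieu 11 (2012) 825–834 (arXiv:1101.4224), §1.
* M. Waldschmidt, *Diophantine approximation on linear algebraic groups*, Springer 2000, §1.4.
* A. Baker, *Transcendental number theory*, CUP 1975, Thm 2.1 (behind Theorem L).
-/

noncomputable section

set_option linter.dupNamespace false

open FirstOrder FirstOrder.Language Set
open Literature.ModelTheory.ExponentialFields
open Literature.NumberTheory.Transcendental

namespace Summit.Schanuel.Schanuel.Theorems.AclSubsetLogFreeCore.Negative

/-! ## §1 Accidental relations between branches of `log 2` and `log 3` feed the hub -/

/-- `e^{ln 3} = 3` in `ℂ`. [folklore] -/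
theorem exp_log_three : Complex.exp (Real.log 3 : ℂ) = 3 := by
  rw [← Complex.ofReal_exp, Real.exp_log three_pos]; norm_num

-- Throughout, `s_R` denotes the set `{x | e^x = 2 ∧ ∃ w (e^w = 3 ∧ R(x, w) = 0)}` of branches of `log 2`
-- algebraically related (through `R ∈ ℤ[X, W]`) to some branch of `log 3` (written out in every statement).

/-- `s_R ⊆ T₂`. -/
theorem branchRelationSet_subset (R : MvPolynomial (Fin 2) ℤ) :
    {x : ℂ | Complex.exp x = 2 ∧ ∃ w : ℂ, Complex.exp w = 3 ∧ MvPolynomial.aeval ![x, w] R = 0} ⊆ {z : ℂ | Complex.exp z = 2} := fun _ h => h.1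

/-- Polynomial maps with integer coefficients in re-indexed variables are `∅`-definable. -/
theorem definableFun_aeval_comp {α : Type*} {n : ℕ} (Q : MvPolynomial (Fin n) ℤ) (ι : Fin n → α) :
    (∅ : Set ℂ).DefinableFun Language.expRing
      (fun w : α → ℂ => MvPolynomial.aeval (fun i => w (ι i)) Q) :=
  definableFun_reindex (definableFun_mvPolynomial_aeval Q) ι

/-- `s_R` is `∅`-definable (an `∃`-formula with integer coefficients). -/
theorem definable₁_branchRelationSet (R : MvPolynomial (Fin 2) ℤ) :
    Set.Definable₁ (∅ : Set ℂ) Language.expRing ({x : ℂ | Complex.exp x = 2 ∧ ∃ w : ℂ, Complex.exp w = 3 ∧ MvPolynomial.aeval ![x, w] R = 0}) := by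
  unfold Set.Definable₁
  simp only [Set.mem_setOf_eq]
  have h2 : (∅ : Set ℂ).DefinableFun Language.expRing (fun _ : Fin 1 → ℂ => (2 : ℂ)) := by
    simpa using definableFun_natCast' (A := (∅ : Set ℂ)) (α := Fin 1) 2
  have h3 : (∅ : Set ℂ).DefinableFun Language.expRing (fun _ : Fin 1 ⊕ Unit → ℂ => (3 : ℂ)) := by
    simpa using definableFun_natCast' (A := (∅ : Set ℂ)) (α := Fin 1 ⊕ Unit) 3
  have hR : (∅ : Set ℂ).DefinableFun Language.expRing
      (fun w : Fin 1 ⊕ Unit → ℂ => MvPolynomial.aeval ![w (Sum.inl 0), w (Sum.inr ())] R) := by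
    have h := definableFun_aeval_comp R (![Sum.inl 0, Sum.inr ()] : Fin 2 → Fin 1 ⊕ Unit)
    convert h using 1
    funext w
    have hv : (![w (Sum.inl 0), w (Sum.inr ())] : Fin 2 → ℂ) =
        fun i => w ((![Sum.inl 0, Sum.inr ()] : Fin 2 → Fin 1 ⊕ Unit) i) := by
      ext i; fin_cases i <;> rfl
    rw [hv]
  refine definable_setOf_and_params ?_ ?_
  · exact definable_setOf_eq_params (definableFun_cexp (definableFun_proj_params _)) h2
  · refine definable_setOf_exists_params (definable_setOf_and_params ?_ ?_)
    · exact definable_setOf_eq_params (definableFun_cexp (definableFun_proj_params _)) h3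
    · exact definable_setOf_eq_params hR definableFun_zero'

/-- `ln 2, ln 3, 2πi` are `ℚ`-linearly independent (`2^a 3^b ≠ 1`). [folklore] -/
theorem linearIndependent_log_two_log_three_two_pi_I :
    LinearIndependent ℚ ![(Real.log 2 : ℂ), (Real.log 3 : ℂ), 2 * Real.pi * Complex.I] := by
  rw [Fintype.linearIndependent_iff]
  intro g hg
  simp only [Fin.sum_univ_three, Matrix.cons_val_zero, Matrix.cons_val_one,
    Matrix.cons_val_two, Matrix.tail_cons, Matrix.head_cons, Rat.smul_def] at hg
  have him := congrArg Complex.im hg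
  have hre := congrArg Complex.re hg
  simp only [Complex.add_im, Complex.mul_im, Complex.ratCast_re, Complex.ratCast_im,
    Complex.ofReal_re, Complex.ofReal_im, Complex.add_re, Complex.mul_re, Complex.I_re,
    Complex.I_im, Complex.re_ofNat, Complex.im_ofNat, Complex.zero_re, Complex.zero_im,
    mul_zero, zero_mul, sub_zero, add_zero, mul_one, zero_add] at him hre
  -- him : g 2 * (2 * π) = 0 ;  hre : g 0 * log 2 + g 1 * log 3 = 0
  have h2 : g 2 = 0 := by
    have : (g 2 : ℝ) = 0 := by
      rcases mul_eq_zero.1 him with h | h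
      · exact h
      · exfalso; linarith [Real.pi_pos]
    exact_mod_cast this
  -- the real equation
  have h01 : g 0 = 0 ∧ g 1 = 0 := by
    have hlog2 : Real.log 2 ≠ 0 := by positivity
    by_cases hb : g 1 = 0
    · refine ⟨?_, hb⟩
      rw [hb] at hre
      have : (g 0 : ℝ) * Real.log 2 = 0 := by simpa using hre
      rcases mul_eq_zero.1 this with h | h
      · exact_mod_cast h
      · exact absurd h hlog2
    · exfalso
      -- ln 3 = q ln 2 with q = -g 0 / g 1, so 3 = 2 ^ q
      set q : ℚ := -g 0 / g 1 with hq
      have hb' : (g 1 : ℝ) ≠ 0 := by exact_mod_cast hb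
      have hlog3 : Real.log 3 = (q : ℝ) * Real.log 2 := by
        rw [hq]; push_cast
        field_simp
        linear_combination hre
      have h3 : (3 : ℝ) = 2 ^ (q : ℝ) := by
        rw [Real.rpow_def_of_pos two_pos, mul_comm, ← hlog3, Real.exp_log three_pos]
      -- write q = n / d
      have hqnd : (q : ℝ) = (q.num : ℝ) / (q.den : ℝ) := by exact_mod_cast (Rat.num_div_den q).symm
      have hdpos : 0 < q.den := q.den_pos
      have h3d : (3 : ℝ) ^ (q.den : ℕ) = (2 : ℝ) ^ (q.num : ℤ) := by
        have : ((2 : ℝ) ^ (q : ℝ)) ^ (q.den : ℕ) = (2 : ℝ) ^ (q.num : ℝ) := by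
          rw [← Real.rpow_natCast, ← Real.rpow_mul two_pos.le, hqnd]
          congr 1
          field_simp
        rw [h3, this, Real.rpow_intCast]
      -- the exponent `q.num` is non-negative
      have hnum : 0 ≤ q.num := by
        by_contra hneg
        push Not at hneg
        have hlt : (2 : ℝ) ^ (q.num : ℤ) < 1 := zpow_lt_one_of_neg₀ (by norm_num) hneg
        have hge : (1 : ℝ) ≤ (3 : ℝ) ^ (q.den : ℕ) := one_le_pow₀ (by norm_num)
        linarith
      obtain ⟨n, hn⟩ := Int.eq_ofNat_of_zero_le hnum
      rw [hn, zpow_natCast] at h3d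
      have hnat : (3 : ℕ) ^ q.den = 2 ^ n := by exact_mod_cast h3d
      -- parity
      rcases Nat.eq_zero_or_pos n with hn0 | hnpos
      · rw [hn0, pow_zero] at hnat
        have : q.den = 0 := (Nat.pow_eq_one.1 hnat).resolve_left (by norm_num)
        omega
      · have h2dvd : 2 ∣ 3 ^ q.den := ⟨2 ^ (n - 1), by
          rw [hnat, ← pow_succ', Nat.sub_add_cancel hnpos]⟩
        have := Nat.Prime.dvd_of_dvd_pow Nat.prime_two h2dvd
        omega
  intro i
  fin_cases i
  · exact h01.1
  · exact h01.2
  · exact h2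

/-- **Theorem L (route support `TwoLogsBranchRelationFinite`, taken as a hypothesis) makes `s_R`
finite** for non-constant `R`. -/
theorem finite_branchRelationSet
    (hL : Summit.Schanuel.Schanuel.Theses.RigidCore.TwoLogsBranchRelationFinite)
    (R : MvPolynomial (Fin 2) ℤ) (hR : 0 < R.totalDegree) :
    ({x : ℂ | Complex.exp x = 2 ∧ ∃ w : ℂ, Complex.exp w = 3 ∧ MvPolynomial.aeval ![x, w] R = 0}).Finite := by
  set R' : MvPolynomial (Fin 2) (algebraicClosure ℚ ℂ) :=
    MvPolynomial.map (algebraMap ℤ (algebraicClosure ℚ ℂ)) R with hR'def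
  have hR' : 0 < R'.totalDegree := by
    -- an injective coefficient map preserves the support, hence the total degree
    simpa only [hR'def, MvPolynomial.totalDegree, MvPolynomial.support_map_of_injective R
      (algebraMap ℤ (algebraicClosure ℚ ℂ)).injective_int] using hR
  have halg2 : IsAlgebraic ℚ (Complex.exp (Real.log 2 : ℂ)) := by
    rw [exp_log_two]; exact_mod_cast isAlgebraic_nat (R := ℚ) (A := ℂ) 2
  have halg3 : IsAlgebraic ℚ (Complex.exp (Real.log 3 : ℂ)) := by
    rw [exp_log_three]; exact_mod_cast isAlgebraic_nat (R := ℚ) (A := ℂ) 3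
  have hfin := hL (Real.log 2) (Real.log 3) halg2 halg3
    linearIndependent_log_two_log_three_two_pi_I R' hR'
  refine (hfin.image fun p : ℤ × ℤ =>
    (Real.log 2 : ℂ) + 2 * Real.pi * Complex.I * (p.1 : ℂ)).subset ?_
  rintro x ⟨hx, w, hw, hrel⟩
  obtain ⟨j, rfl⟩ := mem_logTwoBranches_iff.1 hx
  have hw' : ∃ k : ℤ, w = Real.log 3 + k * (2 * Real.pi * Complex.I) := by
    rw [← exp_log_three, Complex.exp_eq_exp_iff_exists_int] at hw
    exact hw
  obtain ⟨k, rfl⟩ := hw'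
  refine ⟨(j, k), ?_, by push_cast; ring⟩
  show MvPolynomial.aeval
      ![(Real.log 2 : ℂ) + 2 * ↑Real.pi * Complex.I * ((j, k).1 : ℂ),
        (Real.log 3 : ℂ) + 2 * ↑Real.pi * Complex.I * ((j, k).2 : ℂ)] R' = 0
  rw [hR'def, MvPolynomial.aeval_map_algebraMap]
  convert hrel using 2
  ext i
  fin_cases i
  · simp; ring
  · simp; ring

/-- **An accidental algebraic relation between a branch of `log 2` and a branch of `log 3` makes
`ln 2` pointwise `∅`-definable** (modulo Theorem L): `s_R` is then a finite non-empty `∅`-definable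
set of branches of `log 2`. -/
theorem log_two_mem_expDcl_of_branchRelation
    (hL : Summit.Schanuel.Schanuel.Theses.RigidCore.TwoLogsBranchRelationFinite)
    {R : MvPolynomial (Fin 2) ℤ} (hR : 0 < R.totalDegree) {j k : ℤ}
    (hrel : MvPolynomial.aeval ![(Real.log 2 : ℂ) + j * (2 * Real.pi * Complex.I),
      (Real.log 3 : ℂ) + k * (2 * Real.pi * Complex.I)] R = 0) :
    (Real.log 2 : ℂ) ∈ expDcl := by
  refine log_two_mem_expDcl_of_finite_definable_subset (finite_branchRelationSet hL R hR)
    (definable₁_branchRelationSet R) (branchRelationSet_subset R) ⟨_, log_two_add_mem_logTwoBranches j,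
      (Real.log 3 : ℂ) + k * (2 * Real.pi * Complex.I), ?_, hrel⟩
  rw [Complex.exp_add, exp_log_three, Complex.exp_int_mul_two_pi_mul_I, mul_one]

/-- Hence **(A) ∧ Theorem L ∧ [one relation `R(ln 2 + 2πij, ln 3 + 2πik) = 0`] ⇒ `ln 2 ∈ C_EA`**:
the `ℂ`-shadow of the failure of (A) in a Bays–Kirby field built on an accidental relation. -/
theorem log_two_mem_logFreeCore_of_crux_of_branchRelation
    (hA : Summit.Schanuel.Schanuel.Theses.RigidCore.AclSubsetLogFreeCore)
    (hL : Summit.Schanuel.Schanuel.Theses.RigidCore.TwoLogsBranchRelationFinite)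
    {R : MvPolynomial (Fin 2) ℤ} (hR : 0 < R.totalDegree) {j k : ℤ}
    (hrel : MvPolynomial.aeval ![(Real.log 2 : ℂ) + j * (2 * Real.pi * Complex.I),
      (Real.log 3 : ℂ) + k * (2 * Real.pi * Complex.I)] R = 0) :
    (Real.log 2 : ℂ) ∈ logFreeCore :=
  log_two_mem_logFreeCore_of_crux hA (log_two_mem_expDcl_of_branchRelation hL hR hrel)

/-- **CALIBRATION: (A) is not soft.**  Granting the route's Baker-level support item Theorem L,
(A) implies: `ln 2 ∈ C_EA` (false under Schanuel's conjecture) OR `log 2` and `log 3` are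
algebraically independent over `ℚ` in every pair of branches (an open problem of transcendence
theory). -/
theorem logFree_or_allBranchIndep_of_crux
    (hL : Summit.Schanuel.Schanuel.Theses.RigidCore.TwoLogsBranchRelationFinite)
    (hA : Summit.Schanuel.Schanuel.Theses.RigidCore.AclSubsetLogFreeCore) :
    (Real.log 2 : ℂ) ∈ logFreeCore ∨
      ∀ R : MvPolynomial (Fin 2) ℤ, 0 < R.totalDegree → ∀ j k : ℤ,
        MvPolynomial.aeval ![(Real.log 2 : ℂ) + j * (2 * Real.pi * Complex.I),
          (Real.log 3 : ℂ) + k * (2 * Real.pi * Complex.I)] R ≠ 0 := by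
  by_cases h : (Real.log 2 : ℂ) ∈ logFreeCore
  · exact Or.inl h
  · exact Or.inr fun R hR j k hrel =>
      h (log_two_mem_logFreeCore_of_crux_of_branchRelation hA hL hR hrel)

/-! ## §2 The KMO hinge: `ln 2 ∈ dcl(∅)` makes every `2^{1/n}` pointwise definable -/

/-- `ln 2 ∈ dcl(∅) ⇒ 2^{1/n} = e^{(ln 2)/n} ∈ dcl(∅)` (`n ≥ 1`); for `n = 3` this is an algebraic
number outside `ℚ^{ab}`, which Kirby–Macintyre–Onshuus expect NOT to be `∅`-definable in `ℂ_exp`. -/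
theorem root_two_mem_expDcl_of_log_two_mem_expDcl (h : (Real.log 2 : ℂ) ∈ expDcl) {n : ℕ}
    (hn : n ≠ 0) : (((2 : ℝ) ^ ((n : ℝ)⁻¹) : ℝ) : ℂ) ∈ expDcl := by
  have key : (((2 : ℝ) ^ ((n : ℝ)⁻¹) : ℝ) : ℂ) = Complex.exp ((Real.log 2 : ℂ) / (n : ℂ)) := by
    rw [Real.rpow_def_of_pos two_pos, Complex.ofReal_exp]
    push_cast
    ring_nf
  rw [key]
  exact exp_div_natCast_mem_expDcl h hn

/-- **Symmetry ⇒ transcendence through the hub.** Granting Theorem L: if some `2^{1/n}` (`n ≥ 1`) is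
NOT pointwise `∅`-definable in `ℂ_exp`, then `log 2` and `log 3` are algebraically independent over
`ℚ` in all branches. -/
theorem allBranchIndep_of_root_two_not_mem_expDcl
    (hL : Summit.Schanuel.Schanuel.Theses.RigidCore.TwoLogsBranchRelationFinite)
    {n : ℕ} (hn : n ≠ 0) (h : (((2 : ℝ) ^ ((n : ℝ)⁻¹) : ℝ) : ℂ) ∉ expDcl)
    (R : MvPolynomial (Fin 2) ℤ) (hR : 0 < R.totalDegree) (j k : ℤ) :
    MvPolynomial.aeval ![(Real.log 2 : ℂ) + j * (2 * Real.pi * Complex.I),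
      (Real.log 3 : ℂ) + k * (2 * Real.pi * Complex.I)] R ≠ 0 := fun hrel =>
  h (root_two_mem_expDcl_of_log_two_mem_expDcl (log_two_mem_expDcl_of_branchRelation hL hR hrel) hn)

/-! ## §3 Automorphisms of `ℂ_exp` and the hub -/

/-- `∅`-definable sets of tuples are stable under every automorphism of `ℂ_exp`. [folklore] -/
theorem equiv_comp_mem_of_definable {α : Type*} {s : Set (α → ℂ)}
    (hs : (∅ : Set ℂ).Definable Language.expRing s) (σ : Language.expRing.Equiv ℂ ℂ)
    {v : α → ℂ} (hv : v ∈ s) : (σ ∘ v) ∈ s := by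
  obtain ⟨φ, rfl⟩ := Set.empty_definable_iff.1 hs
  exact (FirstOrder.Language.StrongHomClass.realize_formula σ φ (v := v)).2 hv

/-- `∅`-definable subsets of `ℂ` are stable under every automorphism of `ℂ_exp`. [folklore] -/
theorem equiv_mem_of_definable₁ {s : Set ℂ} (hs : Set.Definable₁ (∅ : Set ℂ) Language.expRing s)
    (σ : Language.expRing.Equiv ℂ ℂ) {a : ℂ} (ha : a ∈ s) : σ a ∈ s :=
  equiv_comp_mem_of_definable hs σ (v := fun _ : Fin 1 => a) ha

/-- Automorphisms of `ℂ_exp` fix `dcl(∅)` pointwise. [folklore] -/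
theorem equiv_apply_eq_of_mem_expDcl {a : ℂ} (ha : a ∈ expDcl) (σ : Language.expRing.Equiv ℂ ℂ) :
    σ a = a :=
  equiv_mem_of_definable₁ ha σ rfl

/-- `∅`-algebraic numbers have finite `Aut(ℂ_exp)`-orbits. [folklore] -/
theorem finite_orbit_of_mem_expAcl {a : ℂ} (ha : a ∈ expAcl) :
    (Set.range fun σ : Language.expRing.Equiv ℂ ℂ => σ a).Finite := by
  obtain ⟨s, hs, hdef, has⟩ := ha
  exact hs.subset (by rintro _ ⟨σ, rfl⟩; exact equiv_mem_of_definable₁ hdef σ has)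

/-- ONE automorphism of `ℂ_exp` moving `ln 2` denies the hub … -/
theorem log_two_not_mem_expDcl_of_equiv_apply_ne (σ : Language.expRing.Equiv ℂ ℂ)
    (h : σ (Real.log 2 : ℂ) ≠ Real.log 2) : (Real.log 2 : ℂ) ∉ expDcl :=
  fun hd => h (equiv_apply_eq_of_mem_expDcl hd σ)

/-- … hence settles the instance (A)|_{T₂} (vacuously: then NO branch of `log 2` is `∅`-algebraic) … -/
theorem branch_not_mem_expAcl_of_equiv_apply_ne (σ : Language.expRing.Equiv ℂ ℂ)
    (h : σ (Real.log 2 : ℂ) ≠ Real.log 2) (k : ℤ) :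
    (Real.log 2 : ℂ) + k * (2 * Real.pi * Complex.I) ∉ expAcl :=
  fun hk => log_two_not_mem_expDcl_of_equiv_apply_ne σ h ((branch_mem_expAcl_iff k).1 hk)

/-- … and, modulo Theorem L, proves the all-branch algebraic independence of `log 2` and `log 3`
(compare the route's support `EndomorphismMovingLogTwo`: an endomorphism moving `ln 2` gives
`π ⊥ ln 2` by Lindemann alone). -/
theorem allBranchIndep_of_equiv_apply_ne
    (hL : Summit.Schanuel.Schanuel.Theses.RigidCore.TwoLogsBranchRelationFinite)
    (σ : Language.expRing.Equiv ℂ ℂ) (h : σ (Real.log 2 : ℂ) ≠ Real.log 2)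
    (R : MvPolynomial (Fin 2) ℤ) (hR : 0 < R.totalDegree) (j k : ℤ) :
    MvPolynomial.aeval ![(Real.log 2 : ℂ) + j * (2 * Real.pi * Complex.I),
      (Real.log 3 : ℂ) + k * (2 * Real.pi * Complex.I)] R ≠ 0 := fun hrel =>
  log_two_not_mem_expDcl_of_equiv_apply_ne σ h (log_two_mem_expDcl_of_branchRelation hL hR hrel)

/-- **What a refutation of (A) does to the symmetric programme**: it produces a real number outside
`C_EA` that is fixed by EVERY automorphism of `ℂ_exp` — so `Aut(ℂ_exp)` would NOT move every
non-log-free number, against what Zilber's conjecture (homogeneity of `𝔹` over the kernel, plus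
L1 `acl^𝔹(∅) = EA(SK)`) predicts. -/
theorem exists_fixed_real_not_mem_of_not
    (h : ¬ Summit.Schanuel.Schanuel.Theses.RigidCore.AclSubsetLogFreeCore) :
    ∃ r : ℝ, (r : ℂ) ∉ logFreeCore ∧ ∀ σ : Language.expRing.Equiv ℂ ℂ, σ (r : ℂ) = r := by
  obtain ⟨r, hr, hn⟩ := exists_real_mem_expDcl_not_mem_of_not h
  exact ⟨r, hn, fun σ => equiv_apply_eq_of_mem_expDcl hr σ⟩

end Summit.Schanuel.Schanuel.Theorems.AclSubsetLogFreeCore.Negative
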